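import Literature.NumberTheory.Automorphic.HilbertRepOrthogonalDecomposition
import Literature.NumberTheory.Automorphic.QuaternionUnitsSpectrumDiscrete
import Literature.NumberTheory.Automorphic.AutomorphicQuotientErgodic
import Literature.NumberTheory.Automorphic.JacquetLanglandsParts
import HarnessLib

/-!
# Multiplicity one for `D^×` in terms of one orthogonal decomposition of `L²(D_𝔸ˣ ⧸ ℝ_{>0} Dˣ)`
(Gelbart, *Automorphic forms on adele groups* (1975), Thm. 10.10, p. 158, and pp. 151–153)

Topic `NumberTheory/Automorphic`; theorems only. Part of the inline (D-0026) decomposition of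
the named fact `Literature.NumberTheory.Automorphic.multiplicity_one_quaternionUnits K D`
(Gelbart Thm. 10.10: in `L²(D_𝔸ˣ ⧸ ℝ_{>0} Dˣ)` two unitarily equivalent irreducible closed
invariant subspaces coincide, `HasMultiplicityOne`), which Gelbart proves by comparing, through
the trace formula, the multiplicities `m(π')` *in a fixed orthogonal decomposition*
`R'_ψ = ⊕ π^j` of `L²` (p. 151) with those of `GL₂` ("if `π'` occurs twice then the
corresponding `π(π')` would have to occur twice in `R_0^ψ`", p. 158), the one-dimensional
constituents `g ↦ χ(N g)` being outside the correspondence ("(most of) the constituents").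
This file reduces the fact to exactly that output of the comparison:

* `AdelicGroupData.exists_orthogonalDecomposition_rightRegular_units` — for a division
  quaternion algebra `D` and an automorphic measure `μ`, **`L²(D_𝔸ˣ ⧸ ℝ_{>0} Dˣ)` is the
  orthogonal Hilbert sum of irreducible closed invariant subspaces**: there is a set `S` of
  pairwise orthogonal irreducible closed subrepresentations with closed span `L²` (discrete
  decomposability, `isDiscretelyDecomposable_rightRegular_units` of
  `QuaternionUnitsSpectrumDiscrete`, with `IsUnitary.exists_orthogonalDecomposition_of_isDiscretelyDecomposable`
  of `HilbertRepOrthogonalDecomposition`); every irreducible closed subrepresentation of `L²` is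
  unitarily equivalent to a member of `S` (`…exists_mem_areUnitarilyEquivalent_units`), and the
  multiplicity of any `σ` in `L²` is the number of members of `S` equivalent to `σ`
  (`…multiplicity_rightRegular_units_eq_card`) — Gelbart's `m(π)`.
* `AdelicGroupData.not_areUnitarilyEquivalent_of_finrank_eq_one` — in such an `S`, a
  one-dimensional member is equivalent to no other member (ergodicity:
  `closedSubrep_eq_of_finrank_eq_one` of `AutomorphicQuotientErgodic`), for any adelic group
  datum with `G(𝔸_K)` locally compact and second countable.
* `multiplicity_one_quaternionUnits_of_forall_exists_orthogonalDecomposition` — **the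
  criterion**: if for every automorphic measure some orthogonal decomposition `S` of
  `L²(D_𝔸ˣ ⧸ ℝ_{>0} Dˣ)` into irreducibles has its members *of dimension `≠ 1`* pairwise
  inequivalent, then `multiplicity_one_quaternionUnits K D` holds; and conversely
  (`multiplicity_one_quaternionUnits.set_pairwise_not_areUnitarilyEquivalent`: under multiplicity
  one all members of every decomposition are pairwise inequivalent), packaged as
  `multiplicity_one_quaternionUnits_iff_forall_exists_orthogonalDecomposition`.
* `multiplicity_one_quaternionUnits_of_forall_not_isOrtho`,
  `multiplicity_one_quaternionUnits_iff_forall_not_isOrtho` — the same criterion in **pair form**: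
  multiplicity one holds iff no two *orthogonal* irreducible closed invariant subspaces of
  dimension `≠ 1` are unitarily equivalent — the conclusion shape of the abstract transport
  `not_isOrtho_of_equivalent_of_hilbertSchmidt_le` (`HilbertRepTraceComparisonMultiplicity`,
  Jacquet–Langlands' Lemma 16.1.1 (i) in multiplicity form) through which Gelbart's proof moves
  multiplicity one from `GL₂` to `D^×`.

What remains for `multiplicity_one_quaternionUnits` is therefore precisely Gelbart's comparison
`m(π') = m(π(π')) ≤ 1` for the constituents `π'` of dimension `> 1` (Thm. 10.5 (ii) via
(10.12)–(10.15) and multiplicity one for `GL₂`), equivalently the rigidity fact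
`strong_multiplicity_one_quaternionUnits` (`JacquetLanglandsMultiplicityOneReduction`).

## References

* S. Gelbart, *Automorphic forms on adele groups*, Ann. of Math. Studies 83 (1975), §10,
  pp. 151–153, Thm. 10.10 (p. 158) [Gelbart1975].
* J. Dixmier, *C\*-algebras* (1977), 5.4.1–5.4.6 [Dixmier1977].
-/

noncomputable section

open MeasureTheory ContRepresentation
open scoped InnerProductSpace

namespace Literature.NumberTheory.Automorphic

universe u

/-! ### One-dimensional members of a decomposition (any adelic group datum) -/

namespace AdelicGroupData

variable {K : Type} [Field K] [NumberField K] (𝒢 : AdelicGroupData.{u} K)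
  [LocallyCompactSpace 𝒢.Adelic] [SecondCountableTopology 𝒢.Adelic]
  (μ : Measure 𝒢.automorphicQuotient) [𝒢.IsAutomorphicMeasure μ]

/-- **A one-dimensional irreducible closed invariant subspace of `L²(G(𝔸_K) ⧸ A_G G(K))` is
unitarily equivalent to no other closed invariant subspace** (Gelbart (1975), proof of
Thm. 10.10: the one-dimensional constituents occur exactly once; in the tree
`closedSubrep_eq_of_finrank_eq_one`, by ergodicity of `G(𝔸_K)` on the automorphic quotient).
[cite: Gelbart1975, Thm. 10.10 (proof, p. 158)] -/
theorem not_areUnitarilyEquivalent_of_finrank_eq_one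
    {W W' : ClosedSubrep (𝒢.rightRegular μ)} (hW : W.toContRep.IsTopIrreducible)
    (hdim : Module.finrank ℂ W.toSubmodule = 1) (hne : W ≠ W') :
    ¬ AreUnitarilyEquivalent W.toContRep W'.toContRep := fun he =>
  hne (𝒢.closedSubrep_eq_of_finrank_eq_one μ hW hdim he)

/-- In a family of irreducible closed invariant subspaces of `L²(G(𝔸_K) ⧸ A_G G(K))`, **pairwise
inequivalence of the members of dimension `≠ 1` already gives pairwise inequivalence of all
members** (the one-dimensional ones by `not_areUnitarilyEquivalent_of_finrank_eq_one`).
[cite: Gelbart1975, Thm. 10.10 (proof, p. 158)] -/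
theorem set_pairwise_not_areUnitarilyEquivalent_of_finrank_ne_one
    {S : Set (ClosedSubrep (𝒢.rightRegular μ))} (hirr : ∀ W ∈ S, W.toContRep.IsTopIrreducible)
    (h : S.Pairwise fun W W' => Module.finrank ℂ W.toSubmodule ≠ 1 →
      Module.finrank ℂ W'.toSubmodule ≠ 1 → ¬ AreUnitarilyEquivalent W.toContRep W'.toContRep) :
    S.Pairwise fun W W' => ¬ AreUnitarilyEquivalent W.toContRep W'.toContRep := by
  intro W hW W' hW' hWW' he
  by_cases h1 : Module.finrank ℂ W.toSubmodule = 1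
  · exact 𝒢.not_areUnitarilyEquivalent_of_finrank_eq_one μ (hirr W hW) h1 hWW' he
  by_cases h1' : Module.finrank ℂ W'.toSubmodule = 1
  · exact 𝒢.not_areUnitarilyEquivalent_of_finrank_eq_one μ (hirr W' hW') h1' (Ne.symm hWW') he.symm
  exact h hW hW' hWW' h1 h1' he

end AdelicGroupData

/-! ### The decomposition of `L²(D_𝔸ˣ ⧸ ℝ_{>0} Dˣ)` -/

variable (K : Type) [Field K] [NumberField K] (D : Type u) [Ring D] [Algebra K D]
  [IsQuaternionAlgebra K D]

/-- **`L²(D_𝔸ˣ ⧸ ℝ_{>0} Dˣ)` is an orthogonal Hilbert sum of irreducible closed invariant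
subspaces** (Gelbart (1975), p. 151: `R'_ψ = ⊕ π^j`; Gelfand–Graev–Piatetski-Shapiro for the
compact quotient of Fujisaki): for `D` a division quaternion algebra and `μ` an automorphic
measure there is a set `S` of pairwise orthogonal, topologically irreducible closed
subrepresentations of the regular representation on `L²` whose closed span is everything
(`isDiscretelyDecomposable_rightRegular_units` and
`IsUnitary.exists_orthogonalDecomposition_of_isDiscretelyDecomposable`).
[cite: Gelbart1975, §10 (p. 151)] -/
theorem AdelicGroupData.exists_orthogonalDecomposition_rightRegular_units
    (hdiv : ∀ x : D, x ≠ 0 → IsUnit x) (μ : Measure (AdelicGroupData.units K D).automorphicQuotient)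
    [(AdelicGroupData.units K D).IsAutomorphicMeasure μ] :
    ∃ S : Set (ClosedSubrep ((AdelicGroupData.units K D).rightRegular μ)),
      (∀ W ∈ S, W.toContRep.IsTopIrreducible) ∧
      S.Pairwise (fun W W' => W.toSubmodule ⟂ W'.toSubmodule) ∧
      ClosedSubrep.iSupClosure S = ⊤ :=
  ((AdelicGroupData.units K D).isUnitary_rightRegular μ)
    |>.exists_orthogonalDecomposition_of_isDiscretelyDecomposable
      (AdelicGroupData.isDiscretelyDecomposable_rightRegular_units K D hdiv μ)

/-- **Every irreducible closed invariant subspace of `L²(D_𝔸ˣ ⧸ ℝ_{>0} Dˣ)` — every automorphic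
representation of `D^×` realised in `L²` — is unitarily equivalent to a member of any orthogonal
decomposition `S` into irreducibles** (`IsUnitary.exists_mem_areUnitarilyEquivalent`).
[cite: Dixmier1977, 5.4.4] -/
theorem AdelicGroupData.exists_mem_areUnitarilyEquivalent_units
    (μ : Measure (AdelicGroupData.units K D).automorphicQuotient)
    [(AdelicGroupData.units K D).IsAutomorphicMeasure μ]
    {S : Set (ClosedSubrep ((AdelicGroupData.units K D).rightRegular μ))}
    (hirr : ∀ W ∈ S, W.toContRep.IsTopIrreducible) (hdense : ClosedSubrep.iSupClosure S = ⊤)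
    (P : DiscreteAutomorphicRep (AdelicGroupData.units K D) μ) :
    ∃ W ∈ S, AreUnitarilyEquivalent P.space.toContRep W.toContRep :=
  ((AdelicGroupData.units K D).isUnitary_rightRegular μ).exists_mem_areUnitarilyEquivalent
    hirr hdense P.irreducible

/-- **Gelbart's `m(π)`**: in an orthogonal decomposition `S` of `L²(D_𝔸ˣ ⧸ ℝ_{>0} Dˣ)` into
irreducibles, the multiplicity of any `σ` in `L²` (`HilbertRepSpectrum.multiplicity`, the
supremum over orthogonal families) is the number of members of `S` equivalent to `σ`
(`IsUnitary.multiplicity_eq_card_of_set`); it is finite for `σ` realised in `L²`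
(`multiplicity_lt_top_units` of `QuaternionUnitsSpectrumDiscrete`).
[cite: Gelbart1975, §10 (p. 151)] [cite: Dixmier1977, 5.4.6] -/
theorem AdelicGroupData.multiplicity_rightRegular_units_eq_card
    (μ : Measure (AdelicGroupData.units K D).automorphicQuotient)
    [(AdelicGroupData.units K D).IsAutomorphicMeasure μ]
    {S : Set (ClosedSubrep ((AdelicGroupData.units K D).rightRegular μ))}
    (hirr : ∀ W ∈ S, W.toContRep.IsTopIrreducible)
    (horth : S.Pairwise fun W W' => W.toSubmodule ⟂ W'.toSubmodule)
    (hdense : ClosedSubrep.iSupClosure S = ⊤)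
    {H' : Type*} [SeminormedAddCommGroup H'] [Module ℂ H']
    (σ : ContRepresentation ℂ (AdelicGroupData.units K D).Adelic H') :
    ((AdelicGroupData.units K D).rightRegular μ).multiplicity σ =
      ENat.card {W : S // AreUnitarilyEquivalent
        (W : ClosedSubrep ((AdelicGroupData.units K D).rightRegular μ)).toContRep σ} :=
  ((AdelicGroupData.units K D).isUnitary_rightRegular μ).multiplicity_eq_card_of_set
    hirr horth hdense σ

/-! ### The criterion -/

/-- **Multiplicity one for `D^×` from one good decomposition** (the shape delivered by Gelbart's
trace-formula comparison, Thm. 10.10 with pp. 151–153). Let `D` be a quaternion algebra over the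
number field `K`. Suppose that whenever `D` is a division algebra and `μ` is an automorphic
measure, some orthogonal decomposition `S` of `L²(D_𝔸ˣ ⧸ ℝ_{>0} Dˣ)` into irreducible closed
invariant subspaces has its members of dimension `≠ 1` pairwise unitarily inequivalent. Then
`multiplicity_one_quaternionUnits K D` holds: the one-dimensional members are inequivalent to
all other members by ergodicity (`set_pairwise_not_areUnitarilyEquivalent_of_finrank_ne_one`),
so all members are pairwise inequivalent, which is multiplicity one
(`IsUnitary.hasMultiplicityOne_iff_set_pairwise`). [cite: Gelbart1975, Thm. 10.10] -/
theorem multiplicity_one_quaternionUnits_of_forall_exists_orthogonalDecomposition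
    (h : ∀ (_hdiv : ∀ x : D, x ≠ 0 → IsUnit x)
      (μ : Measure (AdelicGroupData.units K D).automorphicQuotient)
      [(AdelicGroupData.units K D).IsAutomorphicMeasure μ],
      ∃ S : Set (ClosedSubrep ((AdelicGroupData.units K D).rightRegular μ)),
        (∀ W ∈ S, W.toContRep.IsTopIrreducible) ∧
        S.Pairwise (fun W W' => W.toSubmodule ⟂ W'.toSubmodule) ∧
        ClosedSubrep.iSupClosure S = ⊤ ∧
        S.Pairwise (fun W W' => Module.finrank ℂ W.toSubmodule ≠ 1 →
          Module.finrank ℂ W'.toSubmodule ≠ 1 →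
            ¬ AreUnitarilyEquivalent W.toContRep W'.toContRep)) :
    multiplicity_one_quaternionUnits K D := by
  intro hdiv μ _
  obtain ⟨S, hirr, horth, hdense, hne⟩ := h hdiv μ
  obtain ⟨i₁, i₃⟩ := AdelicGroupData.units_locallyCompactSpace_secondCountableTopology K D
  haveI := i₁
  haveI := i₃
  exact (((AdelicGroupData.units K D).isUnitary_rightRegular μ).hasMultiplicityOne_iff_set_pairwise
    hirr horth hdense).mpr
      ((AdelicGroupData.units K D).set_pairwise_not_areUnitarilyEquivalent_of_finrank_ne_one μ
        hirr hne)

variable {K D} in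
/-- **Conversely, under multiplicity one the members of every orthogonal decomposition of
`L²(D_𝔸ˣ ⧸ ℝ_{>0} Dˣ)` into irreducibles are pairwise inequivalent**
(`IsUnitary.hasMultiplicityOne_iff_set_pairwise`). [cite: Gelbart1975, Thm. 10.10] -/
theorem multiplicity_one_quaternionUnits.set_pairwise_not_areUnitarilyEquivalent
    (h : multiplicity_one_quaternionUnits K D) (hdiv : ∀ x : D, x ≠ 0 → IsUnit x)
    (μ : Measure (AdelicGroupData.units K D).automorphicQuotient)
    [(AdelicGroupData.units K D).IsAutomorphicMeasure μ]
    {S : Set (ClosedSubrep ((AdelicGroupData.units K D).rightRegular μ))}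
    (hirr : ∀ W ∈ S, W.toContRep.IsTopIrreducible)
    (horth : S.Pairwise fun W W' => W.toSubmodule ⟂ W'.toSubmodule)
    (hdense : ClosedSubrep.iSupClosure S = ⊤) :
    S.Pairwise fun W W' => ¬ AreUnitarilyEquivalent W.toContRep W'.toContRep :=
  (((AdelicGroupData.units K D).isUnitary_rightRegular μ).hasMultiplicityOne_iff_set_pairwise
    hirr horth hdense).mp (h hdiv μ)

/-- **Multiplicity one for `D^×` ⟺ for every automorphic measure some (equivalently every)
orthogonal decomposition of `L²(D_𝔸ˣ ⧸ ℝ_{>0} Dˣ)` into irreducibles has pairwise inequivalent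
members of dimension `≠ 1`** (Gelbart (1975), Thm. 10.10 in the form produced by its proof).
[cite: Gelbart1975, Thm. 10.10] -/
theorem multiplicity_one_quaternionUnits_iff_forall_exists_orthogonalDecomposition :
    multiplicity_one_quaternionUnits K D ↔
      ∀ (_hdiv : ∀ x : D, x ≠ 0 → IsUnit x)
        (μ : Measure (AdelicGroupData.units K D).automorphicQuotient)
        [(AdelicGroupData.units K D).IsAutomorphicMeasure μ],
        ∃ S : Set (ClosedSubrep ((AdelicGroupData.units K D).rightRegular μ)),
          (∀ W ∈ S, W.toContRep.IsTopIrreducible) ∧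
          S.Pairwise (fun W W' => W.toSubmodule ⟂ W'.toSubmodule) ∧
          ClosedSubrep.iSupClosure S = ⊤ ∧
          S.Pairwise (fun W W' => Module.finrank ℂ W.toSubmodule ≠ 1 →
            Module.finrank ℂ W'.toSubmodule ≠ 1 →
              ¬ AreUnitarilyEquivalent W.toContRep W'.toContRep) := by
  refine ⟨fun h hdiv μ _ => ?_,
    multiplicity_one_quaternionUnits_of_forall_exists_orthogonalDecomposition K D⟩
  obtain ⟨S, hirr, horth, hdense⟩ :=
    AdelicGroupData.exists_orthogonalDecomposition_rightRegular_units K D hdiv μ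
  exact ⟨S, hirr, horth, hdense,
    (h.set_pairwise_not_areUnitarilyEquivalent hdiv μ hirr horth hdense).mono' fun W W' hWW' _ _ =>
      hWW'⟩

/-! ### The criterion in pair form: no two orthogonal equivalent irreducibles of dimension `≠ 1` -/

/-- **Multiplicity one for `D^×` from the absence of orthogonal equivalent pairs** — the shape in
which Gelbart's proof of Thm. 10.10 delivers it ("if `π'` occurs twice …": two *orthogonal*
irreducible closed invariant subspaces of `L²(D_𝔸ˣ ⧸ ℝ_{>0} Dˣ)` of dimension `≠ 1` are never
unitarily equivalent; the abstract transport along the trace comparison is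
`not_isOrtho_of_equivalent_of_hilbertSchmidt_le` of `HilbertRepTraceComparisonMultiplicity`).
Proof: the members of an orthogonal decomposition into irreducibles
(`exists_orthogonalDecomposition_rightRegular_units`) are pairwise orthogonal, so the hypothesis
makes its members of dimension `≠ 1` pairwise inequivalent, and
`multiplicity_one_quaternionUnits_of_forall_exists_orthogonalDecomposition` applies.
[cite: Gelbart1975, Thm. 10.10 (proof, p. 158)] -/
theorem multiplicity_one_quaternionUnits_of_forall_not_isOrtho
    (h : ∀ (_hdiv : ∀ x : D, x ≠ 0 → IsUnit x)
      (μ : Measure (AdelicGroupData.units K D).automorphicQuotient)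
      [(AdelicGroupData.units K D).IsAutomorphicMeasure μ]
      (W W' : ClosedSubrep ((AdelicGroupData.units K D).rightRegular μ)),
      W.toContRep.IsTopIrreducible → W'.toContRep.IsTopIrreducible →
      Module.finrank ℂ W.toSubmodule ≠ 1 → Module.finrank ℂ W'.toSubmodule ≠ 1 →
      AreUnitarilyEquivalent W.toContRep W'.toContRep → ¬ W.toSubmodule ⟂ W'.toSubmodule) :
    multiplicity_one_quaternionUnits K D := by
  refine multiplicity_one_quaternionUnits_of_forall_exists_orthogonalDecomposition K D
    fun hdiv μ _ => ?_
  obtain ⟨S, hirr, horth, hdense⟩ :=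
    AdelicGroupData.exists_orthogonalDecomposition_rightRegular_units K D hdiv μ
  exact ⟨S, hirr, horth, hdense, fun W hW W' hW' hWW' h1 h1' he =>
    h hdiv μ W W' (hirr W hW) (hirr W' hW') h1 h1' he (horth hW hW' hWW')⟩

/-- **Multiplicity one for `D^×` ⟺ no two orthogonal irreducible closed invariant subspaces of
`L²(D_𝔸ˣ ⧸ ℝ_{>0} Dˣ)` of dimension `≠ 1` are unitarily equivalent** (for `D` division and every
automorphic measure). The forward direction: equivalent irreducibles coincide under multiplicity
one, and a non-zero subspace is not orthogonal to itself. [cite: Gelbart1975, Thm. 10.10] -/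
theorem multiplicity_one_quaternionUnits_iff_forall_not_isOrtho :
    multiplicity_one_quaternionUnits K D ↔
      ∀ (_hdiv : ∀ x : D, x ≠ 0 → IsUnit x)
        (μ : Measure (AdelicGroupData.units K D).automorphicQuotient)
        [(AdelicGroupData.units K D).IsAutomorphicMeasure μ]
        (W W' : ClosedSubrep ((AdelicGroupData.units K D).rightRegular μ)),
        W.toContRep.IsTopIrreducible → W'.toContRep.IsTopIrreducible →
        Module.finrank ℂ W.toSubmodule ≠ 1 → Module.finrank ℂ W'.toSubmodule ≠ 1 →
        AreUnitarilyEquivalent W.toContRep W'.toContRep → ¬ W.toSubmodule ⟂ W'.toSubmodule := by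
  refine ⟨fun h hdiv μ _ W W' hW hW' _ _ he horth => ?_,
    multiplicity_one_quaternionUnits_of_forall_not_isOrtho K D⟩
  have hWW' : W = W' := h hdiv μ W W' hW hW' he
  subst hWW'
  have hbot : W.toSubmodule = ⊥ := Submodule.isOrtho_self.mp horth
  have hnt : Nontrivial W.toSubmodule := ((ContRepresentation.isTopIrreducible_iff _).mp hW).1
  exact (Submodule.nontrivial_iff_ne_bot.mp hnt) hbot

end Literature.NumberTheory.Automorphic
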